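import Literature.Topology.FourManifolds.WhitneyCircleIsotopy
import Literature.Topology.FourManifolds.HomotopySmoothing
import HarnessLib

/-!
# One-parameter families of circles: the generic perturbation step, avoiding fixed curves

Topic `Literature/Topology/FourManifolds`; companion of `GenericCircleStep.lean` (the inductive
step of Whitney's general-position argument *homotopic smoothly embedded circles in a manifold
of dimension `n ≥ 4` are smoothly isotopic*, H. Whitney, *Differentiable manifolds*, Ann. of
Math. 37 (1936), §II Thm. 6 and §§8–9; Milnor 1965, Thm. 8.4).  The version needed for
**links** (moving one component while the others stay fixed; the assembled statement —
componentwise homotopic embedded links in dimension `≥ 4` are isotopic as links — is used in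
dimension `4` to isotope the attaching circles of several `5`-dimensional 2-handles
simultaneously, e.g. onto the meridians of the 1-handles they cancel, Andrews–Curtis 1965 /
Kirby 1989 p. 18: "attaching circles are unknotted and unlinked"): the same perturbation
`chartPerturb G x (rectBump τ δ c α) (angSin c) q` as in
`Literature.Topology.FourManifolds.exists_chartPerturb_stagesGoodOn`, with the same conclusions,
**and in addition** the perturbed family avoids finitely many fixed smooth curves
`γ j : ℝ → V` (the other components, parametrised over `ℝ`) on `A' ∪ (core rectangle)` if it
avoided them on `A'` (`Literature.Topology.FourManifolds.exists_chartPerturb_stagesGoodOn_avoiding`).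
The extra genericity is one more null set: the parameters `(v, w)` for which a perturbed point
with a grip lies on some `γ j` satisfy an affine condition with coefficients parametrised by the
three real variables `(t, θ, s)`, `3 < n` (`addHaar_setOf_exists_smul_add_smul_eq`,
`NullImages.lean`), exactly as for the coincidences of a perturbed point with another point of
its stage.  The proof is that of `exists_chartPerturb_stagesGoodOn`, verbatim, with this fourth
null set added.  Everything here is proved; no definitions, no named facts.

## References

* H. Whitney, *Differentiable manifolds*, Ann. of Math. (2) 37 (1936), 645–680, §II Thm. 6,
  §§8–9. [Whitney1936]
* J. Milnor, *Lectures on the h-cobordism theorem* (1965), Thm. 8.4 and Remark (PDF p. 56).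
  [MilnorHCobordism1965]
* M. W. Hirsch, *Differential Topology*, GTM 33 (1976), Ch. 3 §2 Thm. 2.5. [HirschDT1976]
-/

open scoped Manifold ContDiff Topology Real
open Function Set Filter
open _root_.MeasureTheory _root_.MeasureTheory.Measure

noncomputable section

namespace Literature.Topology.FourManifolds

variable {n : ℕ} {V : Type*} [TopologicalSpace V] [ChartedSpace (EuclideanSpace ℝ (Fin n)) V]

section Step

variable [IsManifold (𝓡 n) ∞ V]

/-- **The generic step, avoiding fixed curves** (Whitney 1936, §§8–9, for links).  Hypotheses
and conclusions of `exists_chartPerturb_stagesGoodOn`, plus: for finitely many smooth curves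
`γ j : ℝ → V` which the family `G` avoids on `A'`, the perturbed family avoids them on
`A' ∪ [τ - δ, τ + δ] × (closed arc of angle α)`.  Where the perturbation has a grip this is
generic (a fourth null set of parameters, the condition being affine in `(v, w)` with
coefficients parametrised by `(t, θ, s)`, `3 < n`); where it has none the family is unchanged
and the hypothesis on `A'` applies. [cite: Whitney1936, §II Thm. 6 and §§8–9] -/
theorem exists_chartPerturb_stagesGoodOn_avoiding (hn : 4 ≤ n) {G : ℝ × (Metric.sphere (0 : EuclideanSpace ℝ (Fin 2)) 1) → V}
    (hG : ContMDiff (𝓘(ℝ, ℝ).prod (𝓡 1)) (𝓡 n) ∞ G) {A : Set (ℝ × (Metric.sphere (0 : EuclideanSpace ℝ (Fin 2)) 1))}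
    (hA : StagesGoodOn n G A) {τ δ c α : ℝ} (hδ : 0 < δ) (hα : 0 < α) (h3α : 3 * α < π / 2)
    {x : V} (hRc : MapsTo G (Icc (τ - 3 * δ) (τ + 3 * δ) ×ˢ circleClosedArc c (3 * α))
      (chartAt (EuclideanSpace ℝ (Fin n)) x).source)
    {ι : Type*} [Finite ι] {C : ι → Set (ℝ × (Metric.sphere (0 : EuclideanSpace ℝ (Fin 2)) 1))} {U : ι → Set V} (hC : ∀ i, IsCompact (C i))
    (hU : ∀ i, IsOpen (U i)) (hCU : ∀ i, MapsTo G (C i) (U i))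
    {κ : Type*} [Finite κ] {γ : κ → ℝ → V} (hγ : ∀ j, ContMDiff 𝓘(ℝ, ℝ) (𝓡 n) ∞ (γ j))
    {A' : Set (ℝ × (Metric.sphere (0 : EuclideanSpace ℝ (Fin 2)) 1))}
    (hA' : ∀ p ∈ A', ∀ j s, G p ≠ γ j s) :
    ∃ q : EuclideanSpace ℝ (Fin n) × EuclideanSpace ℝ (Fin n),
      ContMDiff (𝓘(ℝ, ℝ).prod (𝓡 1)) (𝓡 n) ∞ (chartPerturb G x (rectBump τ δ c α) (angSin c) q) ∧
      StagesGoodOn n (chartPerturb G x (rectBump τ δ c α) (angSin c) q)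
        (A ∪ Icc (τ - δ) (τ + δ) ×ˢ circleClosedArc c α) ∧
      (∀ i, MapsTo (chartPerturb G x (rectBump τ δ c α) (angSin c) q) (C i) (U i)) ∧
      (∀ p, rectBump τ δ c α p = 0 → chartPerturb G x (rectBump τ δ c α) (angSin c) q p = G p) ∧
      ∀ p ∈ A' ∪ Icc (τ - δ) (τ + δ) ×ˢ circleClosedArc c α, ∀ j s,
        chartPerturb G x (rectBump τ δ c α) (angSin c) q p ≠ γ j s := by
  -- ### the bump, the coordinate, the rectangles
  set ρ : ℝ × (Metric.sphere (0 : EuclideanSpace ℝ (Fin 2)) 1) → ℝ := rectBump τ δ c α with hρdef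
  set ℓ : (Metric.sphere (0 : EuclideanSpace ℝ (Fin 2)) 1) → ℝ := angSin c with hℓdef
  set R : Set (ℝ × (Metric.sphere (0 : EuclideanSpace ℝ (Fin 2)) 1)) := Ioo (τ - 3 * δ) (τ + 3 * δ) ×ˢ circleArc c (3 * α) with hRdef
  set Rc : Set (ℝ × (Metric.sphere (0 : EuclideanSpace ℝ (Fin 2)) 1)) := Icc (τ - 3 * δ) (τ + 3 * δ) ×ˢ circleClosedArc c (3 * α) with hRcdef
  set K : Set (ℝ × (Metric.sphere (0 : EuclideanSpace ℝ (Fin 2)) 1)) := Icc (τ - δ) (τ + δ) ×ˢ circleClosedArc c α with hKdef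
  have hρs : ContMDiff (𝓘(ℝ, ℝ).prod (𝓡 1)) 𝓘(ℝ, ℝ) ∞ ρ := contMDiff_rectBump τ δ c α
  have hℓs : ContMDiff (𝓡 1) 𝓘(ℝ, ℝ) ∞ ℓ := contMDiff_angSin c
  have hRo : IsOpen R := isOpen_rect τ δ c α
  have hsuppR : tsupport ρ ⊆ R := tsupport_rectBump_subset_rect hδ hα h3α
  have hRRc : R ⊆ Rc := rect_subset_closedRect τ δ c α
  have hKR : K ⊆ R := core_subset_rect hδ hα h3α
  have hsrcR : MapsTo G R (chartAt (EuclideanSpace ℝ (Fin n)) x).source := fun p hp => hRc (hRRc hp)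
  have hρK : ∀ p ∈ K, ρ p = 1 := fun p hp => rectBump_eq_one_of_mem_core hδ hα h3α hp
  have hρ0 : ∀ p, p ∉ R → ρ p = 0 := fun p hp => by
    by_contra h
    exact hp (hsuppR (subset_tsupport _ (mem_support.2 h)))
  have habsρ : ∀ p, |ρ p| ≤ 1 := fun p => abs_rectBump_le_one τ δ c α p
  have habsℓ : ∀ u, |ℓ u| ≤ 1 := fun u => abs_angSin_le_one c u
  have hnotK : ∀ p, ρ p = 0 → p ∉ K := fun p h hK => by
    have := hρK p hK
    rw [h] at this
    exact zero_ne_one this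
  have hmemA : ∀ p, p ∈ A ∪ K → ρ p = 0 → p ∈ A := fun p hp h =>
    hp.resolve_right (hnotK p h)
  -- ### margins
  obtain ⟨ε₀, hε₀, hε₀P⟩ := exists_pos_forall_add_mem hG.continuous (isCompact_closedRect τ δ c α)
    hRc (isOpen_extChartAt_target (I := 𝓡 n) x) fun p hp =>
      (extChartAt (𝓡 n) x).map_source (by rw [extChartAt_source]; exact hRc hp)
  have hεi : ∀ i, ∃ ε : ℝ, 0 < ε ∧ ∀ p ∈ C i ∩ Rc, ∀ y : EuclideanSpace ℝ (Fin n), ‖y‖ ≤ ε →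
      extChartAt (𝓡 n) x (G p) + y ∈
        (extChartAt (𝓡 n) x).target ∩ (extChartAt (𝓡 n) x).symm ⁻¹' U i := by
    intro i
    refine exists_pos_forall_add_mem hG.continuous
      ((hC i).inter_right (isCompact_closedRect τ δ c α).isClosed) (fun p hp => hRc hp.2)
      ((continuousOn_extChartAt_symm x).isOpen_inter_preimage (isOpen_extChartAt_target x) (hU i))
      fun p hp => ⟨(extChartAt (𝓡 n) x).map_source (by rw [extChartAt_source]; exact hRc hp.2), ?_⟩
    rw [mem_preimage, (extChartAt (𝓡 n) x).left_inv (by rw [extChartAt_source]; exact hRc hp.2)]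
    exact hCU i hp.1
  choose εi hεi_pos hεiP using hεi
  obtain ⟨ε, ⟨hεle0, hεlei⟩, hεpos⟩ : ∃ ε : ℝ, (ε ≤ ε₀ ∧ ∀ i, ε ≤ εi i) ∧ 0 < ε := by
    have h1 : ∀ᶠ ε in 𝓝[>] (0 : ℝ), ε ≤ ε₀ := by
      filter_upwards [Ioc_mem_nhdsGT hε₀] with ε hε using hε.2
    have h2 : ∀ᶠ ε in 𝓝[>] (0 : ℝ), ∀ i, ε ≤ εi i :=
      eventually_all.2 fun i => by
        filter_upwards [Ioc_mem_nhdsGT (hεi_pos i)] with ε hε using hε.2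
    exact ((h1.and h2).and self_mem_nhdsWithin).exists
  -- ### lifted functions and coefficient functions
  set gL : ℝ × ℝ → EuclideanSpace ℝ (Fin n) := fun z => extChartAt (𝓡 n) x (G (z.1, circlePoint z.2)) with hgLdef
  set ρL : ℝ × ℝ → ℝ := fun z => ρ (z.1, circlePoint z.2) with hρLdef
  set ℓL : ℝ × ℝ → ℝ := fun z => ℓ (circlePoint z.2) with hℓLdef
  set PA : Set (ℝ × ℝ) := {z | ((z.1, circlePoint z.2) : ℝ × (Metric.sphere (0 : EuclideanSpace ℝ (Fin 2)) 1)) ∈ R} with hPAdef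
  set SL : Set (ℝ × ℝ) := {z | G (z.1, circlePoint z.2) ∈ (chartAt (EuclideanSpace ℝ (Fin n)) x).source} with hSLdef
  have hPASL : PA ⊆ SL := fun z hz => hsrcR hz
  have hρLd : ContDiff ℝ ∞ ρL := contDiff_rectBump_lift τ δ c α
  have hℓLd : ContDiff ℝ ∞ ℓL := contDiff_angSin_lift c
  have hℓL_apply : ∀ z : ℝ × ℝ, ℓL z = Real.sin (z.2 - c) := fun z => angSin_circlePoint c z.2
  have hDℓL : ∀ z : ℝ × ℝ, fderiv ℝ ℓL z (0, 1) = Real.cos (z.2 - c) := fderiv_angSin_lift_apply c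
  have hgLd : ContDiffOn ℝ ∞ gL SL := contDiffOn_extChartAt_lift hG x
  have hDgLd : ContDiffOn ℝ ∞ (fun z => fderiv ℝ gL z (0, 1)) SL :=
    contDiffOn_fderiv_extChartAt_lift hG x
  set aF : ℝ × ℝ → ℝ := fun z => fderiv ℝ ρL z (0, 1) with haFdef
  set bF : ℝ × ℝ → ℝ := fun z => fderiv ℝ ρL z (0, 1) * ℓL z + ρL z * fderiv ℝ ℓL z (0, 1)
    with hbFdef
  have hDρd : Differentiable ℝ fun z : ℝ × ℝ => fderiv ℝ ρL z (0, 1) :=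
    ((hρLd.fderiv_right (m := ∞) (by simp)).clm_apply contDiff_const).differentiable (by simp)
  have hDℓd : Differentiable ℝ fun z : ℝ × ℝ => fderiv ℝ ℓL z (0, 1) :=
    ((hℓLd.fderiv_right (m := ∞) (by simp)).clm_apply contDiff_const).differentiable (by simp)
  have hρd : Differentiable ℝ ρL := hρLd.differentiable (by simp)
  have hℓd : Differentiable ℝ ℓL := hℓLd.differentiable (by simp)
  have haFd : Differentiable ℝ aF := hDρd
  have hbFd : Differentiable ℝ bF := (hDρd.mul hℓd).add (hρd.mul hDℓd)
  have hgd : DifferentiableOn ℝ gL SL := hgLd.differentiableOn (by simp)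
  have hDgd : DifferentiableOn ℝ (fun z => fderiv ℝ gL z (0, 1)) SL :=
    hDgLd.differentiableOn (by simp)
  -- ### the three null sets
  set μ : Measure (EuclideanSpace ℝ (Fin n) × EuclideanSpace ℝ (Fin n)) := (volume : Measure (EuclideanSpace ℝ (Fin n))).prod volume with hμ
  have hdim2 : Module.finrank ℝ (ℝ × ℝ) < Module.finrank ℝ (EuclideanSpace ℝ (Fin n)) := by
    rw [Module.finrank_prod, Module.finrank_self, finrank_euclideanSpace_fin]
    omega
  have hdim3 : Module.finrank ℝ ((ℝ × ℝ) × ℝ) < Module.finrank ℝ (EuclideanSpace ℝ (Fin n)) := by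
    rw [Module.finrank_prod, Module.finrank_prod, Module.finrank_self, finrank_euclideanSpace_fin]
    omega
  -- (A) vanishing θ-velocity where the perturbation has a grip
  set BadA : Set (EuclideanSpace ℝ (Fin n) × EuclideanSpace ℝ (Fin n)) := {q | ∃ z ∈ PA, (aF z ≠ 0 ∨ bF z ≠ 0) ∧
    aF z • q.1 + bF z • q.2 = -(fderiv ℝ gL z (0, 1))} with hBadA
  have hBadA0 : μ BadA = 0 :=
    addHaar_setOf_exists_smul_add_smul_eq μ hdim2 haFd.differentiableOn hbFd.differentiableOn
      ((hDgd.mono hPASL).neg)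
  -- (B) coincidences of two perturbed points of the rectangle
  set PB : Set ((ℝ × ℝ) × ℝ) := {zz | zz.1 ∈ PA ∧ ((zz.1.1, zz.2) : ℝ × ℝ) ∈ PA} with hPBdef
  set sh : (ℝ × ℝ) × ℝ → ℝ × ℝ := fun zz => (zz.1.1, zz.2) with hshdef
  have hshd : Differentiable ℝ sh :=
    (differentiable_fst.comp differentiable_fst).prodMk differentiable_snd
  set BadB : Set (EuclideanSpace ℝ (Fin n) × EuclideanSpace ℝ (Fin n)) := {q | ∃ zz ∈ PB,
    (ρL zz.1 - ρL (sh zz) ≠ 0 ∨ ρL zz.1 * ℓL zz.1 - ρL (sh zz) * ℓL (sh zz) ≠ 0) ∧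
      (ρL zz.1 - ρL (sh zz)) • q.1 + (ρL zz.1 * ℓL zz.1 - ρL (sh zz) * ℓL (sh zz)) • q.2 =
        gL (sh zz) - gL zz.1} with hBadB
  have hBadB0 : μ BadB = 0 := by
    refine addHaar_setOf_exists_smul_add_smul_eq μ hdim3 ?_ ?_ ?_
    · exact ((hρd.comp differentiable_fst).sub (hρd.comp hshd)).differentiableOn
    · exact (((hρd.comp differentiable_fst).mul (hℓd.comp differentiable_fst)).sub
        ((hρd.comp hshd).mul (hℓd.comp hshd))).differentiableOn
    · exact (hgd.comp hshd.differentiableOn fun zz hzz => hPASL hzz.2).sub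
        (hgd.comp differentiableOn_fst fun zz hzz => hPASL hzz.1)
  -- (C) coincidence of a perturbed point of the rectangle with another point of the stage
  set PC : Set ((ℝ × ℝ) × ℝ) := {zz | zz.1 ∈ PA ∧ sh zz ∈ SL} with hPCdef
  set BadC : Set (EuclideanSpace ℝ (Fin n) × EuclideanSpace ℝ (Fin n)) := {q | ∃ zz ∈ PC, (ρL zz.1 ≠ 0 ∨ ρL zz.1 * ℓL zz.1 ≠ 0) ∧
    ρL zz.1 • q.1 + (ρL zz.1 * ℓL zz.1) • q.2 = gL (sh zz) - gL zz.1} with hBadC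
  have hBadC0 : μ BadC = 0 := by
    refine addHaar_setOf_exists_smul_add_smul_eq μ hdim3 ?_ ?_ ?_
    · exact (hρd.comp differentiable_fst).differentiableOn
    · exact ((hρd.comp differentiable_fst).mul (hℓd.comp differentiable_fst)).differentiableOn
    · exact (hgd.comp hshd.differentiableOn fun zz hzz => hzz.2).sub
        (hgd.comp differentiableOn_fst fun zz hzz => hPASL hzz.1)
  -- (D) a perturbed point of the rectangle on one of the fixed curves `γ j`
  haveI : Countable κ := Finite.to_countable
  set SD : κ → Set ℝ := fun j => {s | γ j s ∈ (chartAt (EuclideanSpace ℝ (Fin n)) x).source}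
    with hSDdef
  set γL : κ → ℝ → EuclideanSpace ℝ (Fin n) := fun j s => extChartAt (𝓡 n) x (γ j s) with hγLdef
  have hγLd : ∀ j, DifferentiableOn ℝ (γL j) (SD j) := fun j s hs => by
    have h1 : ContMDiffAt 𝓘(ℝ, ℝ) 𝓘(ℝ, EuclideanSpace ℝ (Fin n)) ∞ (γL j) s :=
      (contMDiffAt_extChartAt' (I := 𝓡 n) hs).comp s (hγ j s)
    exact ((contMDiffAt_iff_contDiffAt.1 h1).differentiableAt (by simp)).differentiableWithinAt
  set PD : κ → Set ((ℝ × ℝ) × ℝ) := fun j => {zz | zz.1 ∈ PA ∧ zz.2 ∈ SD j} with hPDdef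
  set BadD : Set (EuclideanSpace ℝ (Fin n) × EuclideanSpace ℝ (Fin n)) := ⋃ j, {q | ∃ zz ∈ PD j,
    (ρL zz.1 ≠ 0 ∨ ρL zz.1 * ℓL zz.1 ≠ 0) ∧
      ρL zz.1 • q.1 + (ρL zz.1 * ℓL zz.1) • q.2 = γL j zz.2 - gL zz.1} with hBadD
  have hBadD0 : μ BadD = 0 := by
    refine measure_iUnion_null fun j => ?_
    refine addHaar_setOf_exists_smul_add_smul_eq μ hdim3 ?_ ?_ ?_
    · exact (hρd.comp differentiable_fst).differentiableOn
    · exact ((hρd.comp differentiable_fst).mul (hℓd.comp differentiable_fst)).differentiableOn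
    · exact ((hγLd j).comp differentiableOn_snd fun zz hzz => hzz.2).sub
        (hgd.comp differentiableOn_fst fun zz hzz => hPASL hzz.1)
  -- ### choice of the parameter
  set O : Set (EuclideanSpace ℝ (Fin n) × EuclideanSpace ℝ (Fin n)) := {q | ‖q.1‖ + ‖q.2‖ < ε} with hOdef
  have hOo : IsOpen O := isOpen_lt (continuous_fst.norm.add continuous_snd.norm) continuous_const
  have h0O : (0 : EuclideanSpace ℝ (Fin n) × EuclideanSpace ℝ (Fin n)) ∈ O := by
    simp only [hOdef, mem_setOf_eq, Prod.fst_zero, Prod.snd_zero, norm_zero, add_zero]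
    exact hεpos
  obtain ⟨q, hqO, hqBad'⟩ := exists_mem_notMem_of_measure_zero μ hOo ⟨0, h0O⟩
    (measure_union_null (measure_union_null (measure_union_null hBadA0 hBadB0) hBadC0) hBadD0)
  have hqBad : q ∉ BadA ∪ BadB ∪ BadC := fun h => hqBad' (Or.inl h)
  have hqBadD : q ∉ BadD := fun h => hqBad' (Or.inr h)
  refine ⟨q, ?_⟩
  -- ### smallness consequences
  have hsmall : ∀ p : ℝ × (Metric.sphere (0 : EuclideanSpace ℝ (Fin 2)) 1), ‖ρ p • (q.1 + ℓ p.2 • q.2)‖ ≤ ε := fun p =>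
    (norm_smul_add_smul_le (habsρ p) (habsℓ p.2) _ _).trans hqO.le
  have htgtRc : ∀ p ∈ Rc, extChartAt (𝓡 n) x (G p) + ρ p • (q.1 + ℓ p.2 • q.2) ∈
      (extChartAt (𝓡 n) x).target := fun p hp =>
    hε₀P p hp _ ((hsmall p).trans hεle0)
  have htgt : ∀ p ∈ R, extChartAt (𝓡 n) x (G p) + ρ p • (q.1 + ℓ p.2 • q.2) ∈
      (extChartAt (𝓡 n) x).target := fun p hp => htgtRc p (hRRc hp)
  set G' : ℝ × (Metric.sphere (0 : EuclideanSpace ℝ (Fin 2)) 1) → V := chartPerturb G x ρ ℓ q with hG'def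
  have hG's : ContMDiff (𝓘(ℝ, ℝ).prod (𝓡 1)) (𝓡 n) ∞ G' :=
    contMDiff_chartPerturb hG hρs hℓs hRo hsuppR hsrcR htgt
  have hG'R : ∀ p ∈ R, G' p ∈ (chartAt (EuclideanSpace ℝ (Fin n)) x).source ∧
      extChartAt (𝓡 n) x (G' p) = extChartAt (𝓡 n) x (G p) + ρ p • (q.1 + ℓ p.2 • q.2) :=
    fun p hp => chartPerturb_mem_source (hsrcR hp) (htgt p hp)
  have hG'off : ∀ p, p ∉ R → G' p = G p := fun p hp => chartPerturb_of_eq_zero (hρ0 p hp)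
  have hcoordL : ∀ z ∈ PA, extChartAt (𝓡 n) x (G' (z.1, circlePoint z.2)) =
      gL z + ρL z • (q.1 + ℓL z • q.2) := fun z hz => (hG'R _ hz).2
  refine ⟨hG's, ⟨?_, ?_⟩, ?_, fun p hp => chartPerturb_of_eq_zero hp, ?_⟩
  · -- ### nonvanishing θ-velocity on `A ∪ K`
    intro t s hts
    by_cases hpR : ((t, circlePoint s) : ℝ × (Metric.sphere (0 : EuclideanSpace ℝ (Fin 2)) 1)) ∈ R
    · have hz : ((t, s) : ℝ × ℝ) ∈ PA := hpR
      have key := thetaVel_chartPerturb_eq_zero_iff hG hρs hℓs hRo hsuppR hsrcR htgt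
        (z := (t, s)) hpR
      have hpt : fderiv ℝ (fun z : ℝ × ℝ => ρ (z.1, circlePoint z.2) •
          (q.1 + ℓ (circlePoint z.2) • q.2)) (t, s) (0, 1) = aF (t, s) • q.1 + bF (t, s) • q.2 :=
        fderiv_smul_add_smul_apply (hρd (t, s)) (hℓd (t, s)) q.1 q.2 (0, 1)
      intro h0
      have h1 : fderiv ℝ gL (t, s) (0, 1) + (aF (t, s) • q.1 + bF (t, s) • q.2) = 0 := by
        rw [← hpt]
        exact key.1 h0
      by_cases hgrip : aF (t, s) ≠ 0 ∨ bF (t, s) ≠ 0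
      · exact hqBad (Or.inl (Or.inl ⟨(t, s), hz, hgrip, eq_neg_of_add_eq_zero_right h1⟩))
      · rw [not_or, not_not, not_not] at hgrip
        obtain ⟨ha0, hb0⟩ := hgrip
        have hcos : 0 < Real.cos (s - c) := cos_sub_pos_of_circlePoint_mem_circleArc h3α hα hpR.2
        have hρz : ρL (t, s) = 0 := by
          have hb : fderiv ℝ ρL (t, s) (0, 1) * ℓL (t, s) + ρL (t, s) * fderiv ℝ ℓL (t, s) (0, 1)
              = 0 := hb0
          have ha : fderiv ℝ ρL (t, s) (0, 1) = 0 := ha0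
          rw [ha, zero_mul, zero_add, hDℓL] at hb
          exact (mul_eq_zero.1 hb).resolve_right hcos.ne'
        have hpA : ((t, circlePoint s) : ℝ × (Metric.sphere (0 : EuclideanSpace ℝ (Fin 2)) 1)) ∈ A := hmemA _ hts hρz
        refine hA.1 t s hpA ((thetaVel_eq_zero_iff_fderiv_lift_eq_zero hG (z := (t, s))
          (hsrcR hpR)).2 ?_)
        have ha : aF (t, s) = 0 := ha0
        have hb : bF (t, s) = 0 := hb0
        rw [ha, hb, zero_smul, zero_smul, add_zero, add_zero] at h1
        exact h1
    · have hev : G' =ᶠ[𝓝 ((t, circlePoint s) : ℝ × (Metric.sphere (0 : EuclideanSpace ℝ (Fin 2)) 1))] G :=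
        chartPerturb_eventuallyEq fun h => hpR (hsuppR h)
      rw [thetaVel_congr_of_eventuallyEq hev]
      exact hA.1 t s (hmemA _ hts (hρ0 _ hpR))
  · -- ### separation of the points of `A ∪ K`
    intro t u u' hp heq
    by_contra hne
    have fallback : ρ (t, u) = 0 → G' (t, u') = G (t, u') → False := fun h0 h1 => by
      have hGeq : G (t, u) = G (t, u') := by
        rw [← chartPerturb_of_eq_zero (G := G) (x := x) (ℓ := ℓ) (q := q) h0, ← h1]
        exact heq
      exact hne (hA.2 t u u' (hmemA _ hp h0) hGeq)
    by_cases hpR : ((t, u) : ℝ × (Metric.sphere (0 : EuclideanSpace ℝ (Fin 2)) 1)) ∈ R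
    · obtain ⟨θ, hθI, hθu⟩ := exists_lift_of_mem_circleArc_three_mul hα h3α (u := u) hpR.2
      have hz : ((t, θ) : ℝ × ℝ) ∈ PA := by
        change ((t, circlePoint θ) : ℝ × (Metric.sphere (0 : EuclideanSpace ℝ (Fin 2)) 1)) ∈ R
        rw [hθu]; exact hpR
      have hρu : ρ (t, u) = ρL (t, θ) := by
        change ρ (t, u) = ρ (t, circlePoint θ)
        rw [hθu]
      by_cases hp'R : ((t, u') : ℝ × (Metric.sphere (0 : EuclideanSpace ℝ (Fin 2)) 1)) ∈ R
      · obtain ⟨θ', hθ'I, hθ'u⟩ := exists_lift_of_mem_circleArc_three_mul hα h3α (u := u') hp'R.2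
        have hz' : ((t, θ') : ℝ × ℝ) ∈ PA := by
          change ((t, circlePoint θ') : ℝ × (Metric.sphere (0 : EuclideanSpace ℝ (Fin 2)) 1)) ∈ R
          rw [hθ'u]; exact hp'R
        have hρu' : ρ (t, u') = ρL (t, θ') := by
          change ρ (t, u') = ρ (t, circlePoint θ')
          rw [hθ'u]
        have hθθ' : θ ≠ θ' := fun h => hne (by rw [← hθu, ← hθ'u, h])
        have hE : gL (t, θ) + ρL (t, θ) • (q.1 + ℓL (t, θ) • q.2) =
            gL (t, θ') + ρL (t, θ') • (q.1 + ℓL (t, θ') • q.2) := by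
          rw [← hcoordL _ hz, ← hcoordL _ hz']
          change extChartAt (𝓡 n) x (G' (t, circlePoint θ)) =
            extChartAt (𝓡 n) x (G' (t, circlePoint θ'))
          rw [hθu, hθ'u, heq]
        have hE2 := sub_smul_add_sub_smul_eq hE
        by_cases hgrip : ρL (t, θ) - ρL (t, θ') ≠ 0 ∨
            ρL (t, θ) * ℓL (t, θ) - ρL (t, θ') * ℓL (t, θ') ≠ 0
        · exact hqBad (Or.inl (Or.inr ⟨((t, θ), θ'), ⟨hz, hz'⟩, hgrip, hE2⟩))
        · rw [not_or, not_not, not_not, sub_eq_zero, sub_eq_zero] at hgrip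
          obtain ⟨h1, h2⟩ := hgrip
          have hρz : ρL (t, θ) = 0 := by
            by_contra hρne
            rw [← h1] at h2
            have hℓeq : ℓL (t, θ) = ℓL (t, θ') := mul_left_cancel₀ hρne h2
            rw [hℓL_apply, hℓL_apply] at hℓeq
            exact hθθ' (eq_of_sin_sub_eq hθI hθ'I hℓeq)
          have hρz' : ρL (t, θ') = 0 := h1 ▸ hρz
          exact fallback (hρu.trans hρz) (chartPerturb_of_eq_zero (hρu'.trans hρz'))
      · have hG'p' : G' (t, u') = G (t, u') := hG'off _ hp'R
        by_cases hsrc' : G (t, u') ∈ (chartAt (EuclideanSpace ℝ (Fin n)) x).source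
        · obtain ⟨θ'', hθ''⟩ := circlePoint_surjective u'
          have hzz : (((t, θ), θ'') : (ℝ × ℝ) × ℝ) ∈ PC := by
            refine ⟨hz, ?_⟩
            change G (t, circlePoint θ'') ∈ (chartAt (EuclideanSpace ℝ (Fin n)) x).source
            rw [hθ'']; exact hsrc'
          have hE : gL (t, θ) + ρL (t, θ) • (q.1 + ℓL (t, θ) • q.2) = gL (t, θ'') := by
            rw [← hcoordL _ hz]
            change extChartAt (𝓡 n) x (G' (t, circlePoint θ)) =
              extChartAt (𝓡 n) x (G (t, circlePoint θ''))
            rw [hθu, hθ'', heq, hG'p']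
          have hE2 := smul_add_smul_eq_sub hE
          by_cases hρne : ρL (t, θ) ≠ 0
          · exact hqBad (Or.inr ⟨((t, θ), θ''), hzz, Or.inl hρne, hE2⟩)
          · rw [not_not] at hρne
            exact fallback (hρu.trans hρne) hG'p'
        · refine hsrc' ?_
          rw [← hG'p', ← heq]
          exact (hG'R _ hpR).1
    · have hρu : ρ (t, u) = 0 := hρ0 _ hpR
      have hG'p : G' (t, u) = G (t, u) := hG'off _ hpR
      by_cases hp'R : ((t, u') : ℝ × (Metric.sphere (0 : EuclideanSpace ℝ (Fin 2)) 1)) ∈ R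
      · by_cases hsrc : G (t, u) ∈ (chartAt (EuclideanSpace ℝ (Fin n)) x).source
        · obtain ⟨θ', hθ'I, hθ'u⟩ := exists_lift_of_mem_circleArc_three_mul hα h3α (u := u') hp'R.2
          have hz' : ((t, θ') : ℝ × ℝ) ∈ PA := by
            change ((t, circlePoint θ') : ℝ × (Metric.sphere (0 : EuclideanSpace ℝ (Fin 2)) 1)) ∈ R
            rw [hθ'u]; exact hp'R
          have hρu' : ρ (t, u') = ρL (t, θ') := by
            change ρ (t, u') = ρ (t, circlePoint θ')
            rw [hθ'u]
          obtain ⟨θ'', hθ''⟩ := circlePoint_surjective u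
          have hzz : (((t, θ'), θ'') : (ℝ × ℝ) × ℝ) ∈ PC := by
            refine ⟨hz', ?_⟩
            change G (t, circlePoint θ'') ∈ (chartAt (EuclideanSpace ℝ (Fin n)) x).source
            rw [hθ'']; exact hsrc
          have hE : gL (t, θ') + ρL (t, θ') • (q.1 + ℓL (t, θ') • q.2) = gL (t, θ'') := by
            rw [← hcoordL _ hz']
            change extChartAt (𝓡 n) x (G' (t, circlePoint θ')) =
              extChartAt (𝓡 n) x (G (t, circlePoint θ''))
            rw [hθ'u, hθ'', ← heq, hG'p]
          have hE2 := smul_add_smul_eq_sub hE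
          by_cases hρne : ρL (t, θ') ≠ 0
          · exact hqBad (Or.inr ⟨((t, θ'), θ''), hzz, Or.inl hρne, hE2⟩)
          · rw [not_not] at hρne
            exact fallback hρu (chartPerturb_of_eq_zero (hρu'.trans hρne))
        · refine hsrc ?_
          rw [← hG'p, heq]
          exact (hG'R _ hp'R).1
      · exact fallback hρu (hG'off _ hp'R)
  · -- ### the constraints `C i ↦ U i`
    intro i p hpC
    rw [hG'def]
    by_cases hρp : ρ p = 0
    · rw [chartPerturb_of_eq_zero hρp]
      exact hCU i hpC
    · have hpR : p ∈ R := hsuppR (subset_tsupport _ (mem_support.2 hρp))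
      obtain ⟨-, hyU⟩ := hεiP i p ⟨hpC, hRRc hpR⟩ _ ((hsmall p).trans (hεlei i))
      rw [chartPerturb_eq_of_mem_source (hsrcR hpR)]
      exact hyU
  · -- ### avoidance of the fixed curves on `A' ∪ K`
    intro p hp j s heq
    have fallback : ρ p = 0 → False := fun h0 => by
      have hpA' : p ∈ A' := hp.resolve_right (hnotK p h0)
      rw [hG'def, chartPerturb_of_eq_zero h0] at heq
      exact hA' p hpA' j s heq
    by_cases hpR : p ∈ R
    · obtain ⟨θ, -, hθu⟩ := exists_lift_of_mem_circleArc_three_mul hα h3α (u := p.2) hpR.2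
      have hpθ : ((p.1, circlePoint θ) : ℝ × (Metric.sphere (0 : EuclideanSpace ℝ (Fin 2)) 1)) = p := by
        rw [hθu]
      have hz : ((p.1, θ) : ℝ × ℝ) ∈ PA := by
        change ((p.1, circlePoint θ) : ℝ × (Metric.sphere (0 : EuclideanSpace ℝ (Fin 2)) 1)) ∈ R
        rw [hpθ]; exact hpR
      have hρu : ρ p = ρL (p.1, θ) := by
        change ρ p = ρ (p.1, circlePoint θ)
        rw [hpθ]
      have hsD : s ∈ SD j := by
        change γ j s ∈ (chartAt (EuclideanSpace ℝ (Fin n)) x).source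
        rw [← heq]
        exact (hG'R _ hpR).1
      have hzz : (((p.1, θ), s) : (ℝ × ℝ) × ℝ) ∈ PD j := ⟨hz, hsD⟩
      have hE : gL (p.1, θ) + ρL (p.1, θ) • (q.1 + ℓL (p.1, θ) • q.2) = γL j s := by
        rw [← hcoordL _ hz]
        change extChartAt (𝓡 n) x (G' (p.1, circlePoint θ)) = extChartAt (𝓡 n) x (γ j s)
        rw [hpθ, heq]
      have hE2 := smul_add_smul_eq_sub hE
      by_cases hρne : ρL (p.1, θ) ≠ 0
      · exact hqBadD (mem_iUnion.2 ⟨j, ((p.1, θ), s), hzz, Or.inl hρne, hE2⟩)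
      · rw [not_not] at hρne
        exact fallback (hρu.trans hρne)
    · exact fallback (hρ0 _ hpR)


end Step

/-! ### Whitney's theorem for a circle moving in the complement of fixed curves -/

section Whitney

variable [IsManifold (𝓡 n) ∞ V]

/-- **Whitney (1936) for circles, avoiding fixed curves.**  Let `V` be a Hausdorff `n`-manifold
without boundary, `4 ≤ n`, `e₀ e₁ : S¹ → V` smooth embeddings, `H : ℝ × S¹ → V` a smooth map
with `H (t, ·) = e₀` for `t ≤ 1/4` and `H (t, ·) = e₁` for `t ≥ 3/4`, and let `γ j : ℝ → V` be
finitely many smooth curves which `e₀` and `e₁` avoid.  Then there is a smooth isotopy from `e₀`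
to `e₁` **all of whose stages avoid the curves `γ j`**: the proof of
`isSmoothlyIsotopic_of_contMDiff_homotopy` with the avoiding step
`exists_chartPerturb_stagesGoodOn_avoiding`, the avoidance being propagated rectangle by
rectangle from the ends (where the family is `e₀` or `e₁`) exactly like the goodness of the
stages.  This is the form in which one component of a link is moved while the others (the
curves `γ j ∘ circlePoint`-style parametrisations of the other components) stay fixed.
[cite: Whitney1936, §II Thm. 6 and §§8–9] -/
theorem exists_smoothIsotopy_of_contMDiff_homotopy_avoiding [T2Space V] (hn : 4 ≤ n)
    {H : ℝ × (Metric.sphere (0 : EuclideanSpace ℝ (Fin 2)) 1) → V}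
    (hH : ContMDiff (𝓘(ℝ, ℝ).prod (𝓡 1)) (𝓡 n) ∞ H)
    {e₀ e₁ : (Metric.sphere (0 : EuclideanSpace ℝ (Fin 2)) 1) → V}
    (he₀ : Manifold.IsSmoothEmbedding (𝓡 1) (𝓡 n) ∞ e₀)
    (he₁ : Manifold.IsSmoothEmbedding (𝓡 1) (𝓡 n) ∞ e₁)
    (h₀ : ∀ t : ℝ, t ≤ 1 / 4 → ∀ u, H (t, u) = e₀ u)
    (h₁ : ∀ t : ℝ, 3 / 4 ≤ t → ∀ u, H (t, u) = e₁ u)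
    {κ : Type*} [Finite κ] {γ : κ → ℝ → V} (hγ : ∀ j, ContMDiff 𝓘(ℝ, ℝ) (𝓡 n) ∞ (γ j))
    (hγ₀ : ∀ u j s, e₀ u ≠ γ j s) (hγ₁ : ∀ u j s, e₁ u ≠ γ j s) :
    ∃ F : SmoothIsotopy (𝓡 1) (𝓡 n) e₀ e₁, ∀ t u j s, F.toFun t u ≠ γ j s := by
  -- ### the initial good set
  set A₀ : Set (ℝ × (Metric.sphere (0 : EuclideanSpace ℝ (Fin 2)) 1)) :=
    {p | p.1 ≤ 1 / 4 ∨ 3 / 4 ≤ p.1} with hA₀def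
  have hA₀ : StagesGoodOn n H A₀ := by
    refine ⟨fun t s hts => ?_, fun t u u' htu heq => ?_⟩
    · rcases hts with ht | ht
      · rw [thetaVel_eq_of_stage_eq
          (G := fun p : ℝ × (Metric.sphere (0 : EuclideanSpace ℝ (Fin 2)) 1) => e₀ p.2) (t' := t)
          (fun u => h₀ t ht u) s]
        exact thetaVel_const_ne_zero he₀.contMDiff he₀.isImmersion t s
      · rw [thetaVel_eq_of_stage_eq
          (G := fun p : ℝ × (Metric.sphere (0 : EuclideanSpace ℝ (Fin 2)) 1) => e₁ p.2) (t' := t)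
          (fun u => h₁ t ht u) s]
        exact thetaVel_const_ne_zero he₁.contMDiff he₁.isImmersion t s
    · rcases htu with ht | ht
      · rw [h₀ t ht, h₀ t ht] at heq
        exact he₀.isEmbedding.injective heq
      · rw [h₁ t ht, h₁ t ht] at heq
        exact he₁.isEmbedding.injective heq
  have hA₀' : ∀ p ∈ A₀, ∀ j s, H p ≠ γ j s := by
    rintro ⟨t, u⟩ (ht | ht) j s
    · rw [h₀ t ht u]; exact hγ₀ u j s
    · rw [h₁ t ht u]; exact hγ₁ u j s
  -- ### a Lebesgue number for the cover of `[1/4, 3/4] × S¹` by preimages of chart sources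
  set Q : Set (ℝ × (Metric.sphere (0 : EuclideanSpace ℝ (Fin 2)) 1)) :=
    Icc (1 / 4 : ℝ) (3 / 4) ×ˢ univ with hQdef
  have hQc : IsCompact Q := isCompact_Icc.prod isCompact_univ
  obtain ⟨lam, hlam, hleb⟩ := lebesgue_number_lemma_of_metric hQc
    (c := fun y : V => H ⁻¹' (chartAt (EuclideanSpace ℝ (Fin n)) y).source)
    (fun y => (chartAt (EuclideanSpace ℝ (Fin n)) y).open_source.preimage hH.continuous)
    (fun p _ => mem_iUnion.2 ⟨H p, mem_chart_source _ _⟩)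
  haveI : Nonempty V := ⟨e₀ (circlePoint 0)⟩
  choose! yc hyc using hleb
  -- ### sizes of the rectangles
  set δ₀ : ℝ := min (lam / 4) (1 / 16) with hδ₀def
  set α : ℝ := min (lam / 4) (1 / 4) with hαdef
  have hδ₀ : 0 < δ₀ := lt_min (by linarith) (by norm_num)
  have hδ₀lam : 3 * δ₀ < lam := by
    have : δ₀ ≤ lam / 4 := min_le_left _ _
    linarith
  have hδ₀8 : 2 * δ₀ ≤ 1 / 8 := by
    have : δ₀ ≤ 1 / 16 := min_le_right _ _
    linarith
  have hα : 0 < α := lt_min (by linarith) (by norm_num)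
  have hαlam : 3 * α < lam := by
    have : α ≤ lam / 4 := min_le_left _ _
    linarith
  have h3α : 3 * α < π / 2 := by
    have : α ≤ 1 / 4 := min_le_right _ _
    linarith [Real.two_le_pi]
  have hαπ : α ≤ π := by linarith [Real.two_le_pi]
  -- ### the grid and its chart centres
  obtain ⟨N, M, τ, c, hτ, hcover⟩ := exists_grid_cover hδ₀ hα hαπ
  set xc : Fin (N + 1) × Fin (M + 1) → V := fun i => yc (τ i, circlePoint (c i)) with hxcdef
  set K : Fin (N + 1) × Fin (M + 1) → Set (ℝ × (Metric.sphere (0 : EuclideanSpace ℝ (Fin 2)) 1)) :=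
    fun i => Icc (τ i - δ₀) (τ i + δ₀) ×ˢ circleClosedArc (c i) α with hKdef
  set Rc : Fin (N + 1) × Fin (M + 1) → Set (ℝ × (Metric.sphere (0 : EuclideanSpace ℝ (Fin 2)) 1)) :=
    fun i => Icc (τ i - 3 * δ₀) (τ i + 3 * δ₀) ×ˢ circleClosedArc (c i) (3 * α) with hRcdef
  have hRc0 : ∀ i, MapsTo H (Rc i) (chartAt (EuclideanSpace ℝ (Fin n)) (xc i)).source := by
    intro i p hp
    have hQi : ((τ i, circlePoint (c i)) : ℝ × (Metric.sphere (0 : EuclideanSpace ℝ (Fin 2)) 1)) ∈ Q :=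
      ⟨hτ i, mem_univ _⟩
    have hball := hyc _ hQi
    apply hball
    rw [Metric.mem_ball, Prod.dist_eq, max_lt_iff]
    refine ⟨?_, ?_⟩
    · rw [Real.dist_eq, abs_lt]
      obtain ⟨h1, h2⟩ := hp.1
      exact ⟨by linarith, by linarith⟩
    · exact (dist_le_of_mem_circleClosedArc (by linarith) hp.2).trans_lt hαlam
  -- ### induction over the rectangles of the grid
  have hind : ∀ S : Finset (Fin (N + 1) × Fin (M + 1)),
      ∃ G : ℝ × (Metric.sphere (0 : EuclideanSpace ℝ (Fin 2)) 1) → V,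
      ContMDiff (𝓘(ℝ, ℝ).prod (𝓡 1)) (𝓡 n) ∞ G ∧ StagesGoodOn n G (A₀ ∪ ⋃ i ∈ S, K i) ∧
      (∀ j, MapsTo G (Rc j) (chartAt (EuclideanSpace ℝ (Fin n)) (xc j)).source) ∧
      (∀ p : ℝ × (Metric.sphere (0 : EuclideanSpace ℝ (Fin 2)) 1),
        p.1 ∉ Ioo (1 / 8 : ℝ) (7 / 8) → G p = H p) ∧
      ∀ p ∈ A₀ ∪ ⋃ i ∈ S, K i, ∀ j s, G p ≠ γ j s := by
    intro S
    induction S using Finset.induction_on with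
    | empty =>
      refine ⟨H, hH, ?_, hRc0, fun p _ => rfl, ?_⟩
      · simpa using hA₀
      · simpa using hA₀'
    | @insert i S hiS ih =>
      obtain ⟨G, hGs, hGA, hGRc, hGH, hGγ⟩ := ih
      obtain ⟨q, hG's, hG'A, hG'Rc, hG'eq, hG'γ⟩ := exists_chartPerturb_stagesGoodOn_avoiding hn hGs
        hGA hδ₀ hα h3α (x := xc i) (hGRc i) (fun j => isCompact_closedRect (τ j) δ₀ (c j) α)
        (fun j => (chartAt (EuclideanSpace ℝ (Fin n)) (xc j)).open_source) hGRc hγ hGγ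
      refine ⟨_, hG's, ?_, hG'Rc, fun p hp => ?_, ?_⟩
      · refine hG'A.mono ?_
        intro p hp
        rw [Finset.set_biUnion_insert] at hp
        rcases hp with hp | hp | hp
        · exact Or.inl (Or.inl hp)
        · exact Or.inr hp
        · exact Or.inl (Or.inr hp)
      · rw [hG'eq p ?_, hGH p hp]
        apply rectBump_eq_zero_of_time hδ₀
        intro ht
        apply hp
        obtain ⟨hτ1, hτ2⟩ := hτ i
        exact ⟨by linarith [ht.1], by linarith [ht.2]⟩
      · intro p hp
        apply hG'γ p
        rw [Finset.set_biUnion_insert] at hp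
        rcases hp with hp | hp | hp
        · exact Or.inl (Or.inl hp)
        · exact Or.inr hp
        · exact Or.inl (Or.inr hp)
  obtain ⟨G, hGs, hGA, -, hGH, hGγ⟩ := hind Finset.univ
  -- ### every point is covered
  have hcov : ∀ p : ℝ × (Metric.sphere (0 : EuclideanSpace ℝ (Fin 2)) 1),
      p ∈ A₀ ∪ ⋃ i ∈ (Finset.univ : Finset (Fin (N + 1) × Fin (M + 1))), K i := by
    intro p
    by_cases hp : p.1 ∈ Icc (1 / 4 : ℝ) (3 / 4)
    · obtain ⟨i, hi⟩ := hcover p hp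
      exact Or.inr (mem_iUnion₂.2 ⟨i, Finset.mem_univ i, hi⟩)
    · refine Or.inl ?_
      rw [mem_Icc, not_and_or, not_le, not_le] at hp
      rcases hp with hp | hp
      · exact Or.inl hp.le
      · exact Or.inr hp.le
  -- ### every stage of the final family is good
  have hgood : StagesGoodOn n G univ := hGA.mono fun p _ => hcov p
  -- ### the smooth isotopy
  refine ⟨{ toFun := fun t u => G (t, u)
            contMDiff := hGs
            isSmoothEmbedding := fun t => isSmoothEmbedding_stage hGs hgood t
            map_zero := ?_
            map_one := ?_ }, fun t u j s => hGγ (t, u) (hcov (t, u)) j s⟩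
  · funext u
    rw [hGH (0, u) (fun h => absurd h.1 (by norm_num)), h₀ 0 (by norm_num) u]
  · funext u
    rw [hGH (1, u) (fun h => absurd h.2 (by norm_num)), h₁ 1 (by norm_num) u]

/-- **Whitney (1936): homotopic embedded circles in a closed manifold of dimension `≥ 4` are
isotopic through embeddings avoiding any finitely many fixed smooth curves which the two circles
avoid** (smooth the homotopy, `exists_contMDiff_homotopy_of_homotopic`, then perturb it with
`exists_smoothIsotopy_of_contMDiff_homotopy_avoiding`).  With the `γ j` the (periodic
parametrisations of the) other components of a link this is the one-component move of the
statement "componentwise homotopic links of circles in dimension `≥ 4` are isotopic".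
[cite: Whitney1936, §II Thm. 6 and §§8–9] [cite: MilnorHCobordism1965, Thm. 8.4 and Remark (PDF p. 56)] -/
theorem exists_smoothIsotopy_circle_of_homotopic_avoiding {n : ℕ} (hn : 4 ≤ n) {V : Type*}
    [TopologicalSpace V] [T2Space V] [CompactSpace V] [ChartedSpace (EuclideanSpace ℝ (Fin n)) V]
    [IsManifold (𝓡 n) ∞ V] (e₀ e₁ : C(Metric.sphere (0 : EuclideanSpace ℝ (Fin 2)) 1, V))
    (he₀ : Manifold.IsSmoothEmbedding (𝓡 1) (𝓡 n) ∞ e₀)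
    (he₁ : Manifold.IsSmoothEmbedding (𝓡 1) (𝓡 n) ∞ e₁) (h : e₀.Homotopic e₁)
    {κ : Type*} [Finite κ] {γ : κ → ℝ → V} (hγ : ∀ j, ContMDiff 𝓘(ℝ, ℝ) (𝓡 n) ∞ (γ j))
    (hγ₀ : ∀ u j s, e₀ u ≠ γ j s) (hγ₁ : ∀ u j s, e₁ u ≠ γ j s) :
    ∃ F : SmoothIsotopy (𝓡 1) (𝓡 n) (e₀ : (Metric.sphere (0 : EuclideanSpace ℝ (Fin 2)) 1) → V) e₁,
      ∀ t u j s, F.toFun t u ≠ γ j s := by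
  obtain ⟨H, hH, h0, h1⟩ :=
    exists_contMDiff_homotopy_of_homotopic (IM := 𝓡 1) he₀.contMDiff he₁.contMDiff h
  exact exists_smoothIsotopy_of_contMDiff_homotopy_avoiding hn hH he₀ he₁ h0 h1 hγ hγ₀ hγ₁

/-- **Small generic isotopy of an embedded circle off finitely many fixed curves, inside a
prescribed open set** (Whitney 1936, §§8–9, general position of a circle against curves in
dimension `≥ 4`).  For a smooth embedding `e : S¹ → V` with image in the open set `U` and
finitely many smooth curves `γ j : ℝ → V`, there is a smooth isotopy from `e`, all of whose
stages lie in `U`, to a smooth embedding `e'` avoiding every `γ j`: perturb the *constant*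
family `(t, u) ↦ e u` rectangle by rectangle over `[1/4, 3/4] × S¹` with the avoiding step
(`exists_chartPerturb_stagesGoodOn_avoiding`; the constraints `C i ↦ U i` keep the stages in
`U` and in the chart sources) and stop at time `1/2`. [cite: Whitney1936, §II §§8–9] -/
theorem exists_smoothIsotopy_perturb_avoiding [T2Space V] (hn : 4 ≤ n)
    {e : (Metric.sphere (0 : EuclideanSpace ℝ (Fin 2)) 1) → V}
    (he : Manifold.IsSmoothEmbedding (𝓡 1) (𝓡 n) ∞ e) {U : Set V} (hU : IsOpen U)
    (heU : ∀ u, e u ∈ U)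
    {κ : Type*} [Finite κ] {γ : κ → ℝ → V} (hγ : ∀ j, ContMDiff 𝓘(ℝ, ℝ) (𝓡 n) ∞ (γ j)) :
    ∃ (e' : (Metric.sphere (0 : EuclideanSpace ℝ (Fin 2)) 1) → V)
      (F : SmoothIsotopy (𝓡 1) (𝓡 n) e e'),
      (∀ t u, F.toFun t u ∈ U) ∧ ∀ u j s, e' u ≠ γ j s := by
  -- ### the constant family and its goodness
  set H : ℝ × (Metric.sphere (0 : EuclideanSpace ℝ (Fin 2)) 1) → V := fun p => e p.2 with hHdef
  have hH : ContMDiff (𝓘(ℝ, ℝ).prod (𝓡 1)) (𝓡 n) ∞ H := he.contMDiff.comp contMDiff_snd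
  have hA₀ : StagesGoodOn n H univ :=
    ⟨fun t s _ => thetaVel_const_ne_zero he.contMDiff he.isImmersion t s,
      fun t u u' _ heq => he.isEmbedding.injective heq⟩
  -- ### a Lebesgue number for the cover of `[1/4, 3/4] × S¹` by preimages of chart sources
  set Q : Set (ℝ × (Metric.sphere (0 : EuclideanSpace ℝ (Fin 2)) 1)) :=
    Icc (1 / 4 : ℝ) (3 / 4) ×ˢ univ with hQdef
  have hQc : IsCompact Q := isCompact_Icc.prod isCompact_univ
  obtain ⟨lam, hlam, hleb⟩ := lebesgue_number_lemma_of_metric hQc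
    (c := fun y : V => H ⁻¹' ((chartAt (EuclideanSpace ℝ (Fin n)) y).source ∩ U))
    (fun y => ((chartAt (EuclideanSpace ℝ (Fin n)) y).open_source.inter hU).preimage hH.continuous)
    (fun p _ => mem_iUnion.2 ⟨H p, mem_chart_source _ _, heU p.2⟩)
  rcases isEmpty_or_nonempty (Metric.sphere (0 : EuclideanSpace ℝ (Fin 2)) 1) with hS | hS
  · exact ⟨e, SmoothIsotopy.refl he, fun t u => heU u, fun u => isEmptyElim u⟩
  haveI : Nonempty V := ⟨e (Classical.arbitrary _)⟩
  choose! yc hyc using hleb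
  -- ### sizes of the rectangles
  set δ₀ : ℝ := min (lam / 4) (1 / 16) with hδ₀def
  set α : ℝ := min (lam / 4) (1 / 4) with hαdef
  have hδ₀ : 0 < δ₀ := lt_min (by linarith) (by norm_num)
  have hδ₀lam : 3 * δ₀ < lam := by
    have : δ₀ ≤ lam / 4 := min_le_left _ _
    linarith
  have hδ₀8 : 2 * δ₀ ≤ 1 / 8 := by
    have : δ₀ ≤ 1 / 16 := min_le_right _ _
    linarith
  have hα : 0 < α := lt_min (by linarith) (by norm_num)
  have hαlam : 3 * α < lam := by
    have : α ≤ lam / 4 := min_le_left _ _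
    linarith
  have h3α : 3 * α < π / 2 := by
    have : α ≤ 1 / 4 := min_le_right _ _
    linarith [Real.two_le_pi]
  have hαπ : α ≤ π := by linarith [Real.two_le_pi]
  -- ### the grid and its chart centres
  obtain ⟨N, M, τ, c, hτ, hcover⟩ := exists_grid_cover hδ₀ hα hαπ
  set xc : Fin (N + 1) × Fin (M + 1) → V := fun i => yc (τ i, circlePoint (c i)) with hxcdef
  set K : Fin (N + 1) × Fin (M + 1) → Set (ℝ × (Metric.sphere (0 : EuclideanSpace ℝ (Fin 2)) 1)) :=
    fun i => Icc (τ i - δ₀) (τ i + δ₀) ×ˢ circleClosedArc (c i) α with hKdef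
  set Rc : Fin (N + 1) × Fin (M + 1) → Set (ℝ × (Metric.sphere (0 : EuclideanSpace ℝ (Fin 2)) 1)) :=
    fun i => Icc (τ i - 3 * δ₀) (τ i + 3 * δ₀) ×ˢ circleClosedArc (c i) (3 * α) with hRcdef
  have hRc0 : ∀ i, MapsTo H (Rc i) ((chartAt (EuclideanSpace ℝ (Fin n)) (xc i)).source ∩ U) := by
    intro i p hp
    have hQi : ((τ i, circlePoint (c i)) : ℝ × (Metric.sphere (0 : EuclideanSpace ℝ (Fin 2)) 1)) ∈ Q :=
      ⟨hτ i, mem_univ _⟩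
    have hball := hyc _ hQi
    apply hball
    rw [Metric.mem_ball, Prod.dist_eq, max_lt_iff]
    refine ⟨?_, ?_⟩
    · rw [Real.dist_eq, abs_lt]
      obtain ⟨h1, h2⟩ := hp.1
      exact ⟨by linarith, by linarith⟩
    · exact (dist_le_of_mem_circleClosedArc (by linarith) hp.2).trans_lt hαlam
  -- ### induction over the rectangles of the grid
  have hind : ∀ S : Finset (Fin (N + 1) × Fin (M + 1)),
      ∃ G : ℝ × (Metric.sphere (0 : EuclideanSpace ℝ (Fin 2)) 1) → V,
      ContMDiff (𝓘(ℝ, ℝ).prod (𝓡 1)) (𝓡 n) ∞ G ∧ StagesGoodOn n G univ ∧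
      (∀ j, MapsTo G (Rc j) ((chartAt (EuclideanSpace ℝ (Fin n)) (xc j)).source ∩ U)) ∧
      (∀ p : ℝ × (Metric.sphere (0 : EuclideanSpace ℝ (Fin 2)) 1),
        p.1 ∉ Ioo (1 / 8 : ℝ) (7 / 8) → G p = H p) ∧
      (∀ p, G p ∈ U) ∧
      ∀ p ∈ ⋃ i ∈ S, K i, ∀ j s, G p ≠ γ j s := by
    intro S
    induction S using Finset.induction_on with
    | empty =>
      refine ⟨H, hH, hA₀, hRc0, fun p _ => rfl, fun p => heU p.2, ?_⟩
      simp
    | @insert i S hiS ih =>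
      obtain ⟨G, hGs, hGA, hGRc, hGH, hGU, hGγ⟩ := ih
      obtain ⟨q, hG's, hG'A, hG'Rc, hG'eq, hG'γ⟩ := exists_chartPerturb_stagesGoodOn_avoiding hn hGs
        hGA hδ₀ hα h3α (x := xc i) (fun p hp => (hGRc i hp).1)
        (fun j => isCompact_closedRect (τ j) δ₀ (c j) α)
        (fun j => ((chartAt (EuclideanSpace ℝ (Fin n)) (xc j)).open_source.inter hU)) hGRc hγ
        (A' := ⋃ i ∈ S, K i) hGγ
      refine ⟨_, hG's, hG'A.mono (subset_union_left), hG'Rc, fun p hp => ?_, fun p => ?_, ?_⟩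
      · rw [hG'eq p ?_, hGH p hp]
        apply rectBump_eq_zero_of_time hδ₀
        intro ht
        apply hp
        obtain ⟨hτ1, hτ2⟩ := hτ i
        exact ⟨by linarith [ht.1], by linarith [ht.2]⟩
      · by_cases hρ : rectBump (τ i) δ₀ (c i) α p = 0
        · rw [hG'eq p hρ]; exact hGU p
        · have hpR : p ∈ Rc i :=
            rect_subset_closedRect (τ i) δ₀ (c i) α
              (tsupport_rectBump_subset_rect hδ₀ hα h3α (subset_tsupport _ (mem_support.2 hρ)))
          exact (hG'Rc i hpR).2
      · intro p hp
        apply hG'γ p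
        rw [Finset.set_biUnion_insert] at hp
        rcases hp with hp | hp
        · exact Or.inr hp
        · exact Or.inl hp
  obtain ⟨G, hGs, hGA, -, hGH, hGU, hGγ⟩ := hind Finset.univ
  -- ### the isotopy up to time `1/2`
  have hhalf : ContMDiff (𝓘(ℝ, ℝ).prod (𝓡 1)) (𝓡 n) ∞
      fun p : ℝ × (Metric.sphere (0 : EuclideanSpace ℝ (Fin 2)) 1) => G (p.1 / 2, p.2) :=
    hGs.comp (((contDiff_id.div_const 2).contMDiff.comp contMDiff_fst).prodMk contMDiff_snd)
  refine ⟨fun u => G (1 / 2, u),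
    { toFun := fun t u => G (t / 2, u)
      contMDiff := hhalf
      isSmoothEmbedding := fun t => isSmoothEmbedding_stage hGs hGA (t / 2)
      map_zero := ?_
      map_one := ?_ }, fun t u => hGU _, fun u j s => ?_⟩
  · funext u
    rw [zero_div, hGH (0, u) (fun h => absurd h.1 (by norm_num))]
  · funext u
    norm_num
  · refine hGγ (1 / 2, u) ?_ j s
    obtain ⟨i, hi⟩ := hcover (1 / 2, u) ⟨by norm_num, by norm_num⟩
    exact mem_iUnion₂.2 ⟨i, Finset.mem_univ i, hi⟩

end Whitney

end Literature.Topology.FourManifolds
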